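/-
Copyright (c) 2026 the pub-hodgecm-mathlib formalisation cell (harness21).  Prover seat hodgecm-mathlib-F0P3a-p03 (g18): road «S3-ram» (LEAD F0P3a-plan (g13); owner∕table
F0P3a-p06 (g15)), the type-(2) G-side (Cnt2′) assembly of chair F0P3a-p07 (g14): wrapper «stub_lat ⟸ INTRINSIC» (chair RULING (7) 2026-09-02T02:41:39Z, second half), FILE 1∕2 (row `0` + tokens);
2026-09-02.  Statements generated from the chair's socket texts `F0/P3a/F0P3a-p07/g14/cnt2/socket-T2G_{zero,pm}_lat_{even,odd}.F0P3ap07g14.txt`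
(generator `F0/P3a/F0P3a-p03/g18/wrap/gen_wrap.F0P3ap03g18.py`).
-/
import Literature.NumberTheory.Rogawski1990.DepthZeroKappaTransferTypeTwoRamifiedLatticeCurrency     -- ★ p847724 (F0P3a-p05 (g17)): THE CURRENCY; brings the (Cnt2′) vocabulary, ★ A1′, ★ frames
import Literature.NumberTheory.Rogawski1990.DepthZeroKappaTransferTypeTwoRamifiedFavourableClass     -- ★ (F) p847529 (F0P3a-p07 (g14)): `exists_norm_mul_favourableClass_eq_one_iff_hilbertSymbol_mul_eq_one`
import Literature.NumberTheory.Rogawski1990.FinExplicitTransferFactorDeepTauTame                    -- ★ `exists_units_toPlace_eq_symmDisc_of_deep` (the symmetrised discriminant `β ∈ (L⁺_v)ˣ`)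
import Literature.NumberTheory.Rogawski1990.FinExplicitTransferFactorNondegenerate                 -- ★ `isUnit_eval_finCharpolyTwo_of_isLocalGRegular`
import Literature.NumberTheory.Automorphic.UnitaryGroupInertPlaceHyperbolicBasis                   -- ★ `exists_toPlace_eq_of_galAdicCompletionMap_eq`, ★ `placeForm_hermitian_of_smul_eq`
import Literature.NumberTheory.Automorphic.RamifiedPlaceAntiFixedUniformizer                       -- ★ `valued_toPlace_uniformizer_of_ramified`
import Literature.NumberTheory.Rogawski1990.UnitFundamentalLemmaInertFlickerFrame                  -- ★ `isUnit_two_integer_iff_valued_eq_one`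
import HarnessLib

/-!
# The (Cnt2′) lattice sockets `stub_T2G_zero_{even,odd}_lat` (row `0`) FOLLOW FROM THE INTRINSIC LAW `S_j(t₀) − S_j(t₁) = (β,θ)_v · q^m · X̃_j(n)`
# (Rogawski 1990 §4.9 Prop. 4.9.1, Lemma 4.9.3; Labesse–Langlands 1979 §2)

Topic `NumberTheory/Rogawski1990`; namespace `Literature.NumberTheory.Rogawski1990`.  THEOREMS ONLY (no definition, no instance, no notation, no named fact, no `sorry`); kernel
lane `--supports stmt-HodgeConjecture-24833`.  Cell `pub/hodgecm-mathlib` (D-0151), crux H413; road «S3-ram» (Literature seeding, count-neutral).  The (Cnt2′) chair's skeleton v4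
(`F0/P3a/F0P3a-p07/g14/cnt2/DepthZeroKappaTransferTypeTwoRamifiedSignedCounts{Even,Odd}.skeleton.v4…`) has two open sockets per parity, `stub_T2G_zero_{par}_lat` and
`stub_T2G_pm_{par}_lat` = the `hLat` TYPES of ★ p847724 `stub_T2G_{zero,pm}_{par}_ram_of_lattice` (texts `…/cnt2/socket-T2G_{zero,pm}_lat_{par}.F0P3ap07g14.txt`).  They are
stated for ARBITRARY matches `tp` (`κ = 1`), `tm` (`κ = −1`) and keyed on the FAVOURABLE CLASS `FAV(γ_H) := ∃ z, z·σ_w z·c(γ_H) = 1`,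
`c(γ_H) = det H′_w·χ_g(u)_w ∕ ((1+u_w)²(1 + tr g_w + det g_w))`: `FAV → S_j(tp) − S_j(tm) = +q^m X̃_j(n)`, `¬FAV → … = −q^m X̃_j(n)`.  The organs of the (z4-ii) assembly (axis ★
p847852, tubes (z1-c), cones (z3), W-bridge (z1-f), sign (z5) ★ p848151) compute instead the INTRINSIC LAW of the chair's ROADMAP v1.1 §1′
(`F0/P3a/F0P3a-p07/g14/cnt2/ROADMAP-Cnt2-zero-pm.v1_1.F0P3ap07g14.md`): for literals `t₀`, `t₁` of signs `κ(t₀) = (y_λ,θ)_v`, `κ(t₁) = −(y_λ,θ)_v` (`ι_w y_λ = −det H′_w`),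
**`S_j(t₀) − S_j(t₁) = (β,θ)_v · q^m · X̃_j(n)`**, `β ∈ (L⁺_v)ˣ` the symmetrised discriminant `ι_w β = −χ_g(u)_w (u_w² + det g_w) ∕ (2 u_w² det g_w)`.  THIS FILE proves, per
row and parity, **socket ⟸ intrinsic law** (`stub_T2G_{zero,pm}_{par}_lat_of_intrinsic`): the socket text with its 15 binders VERBATIM, ONE extra hypothesis `hIntr` (the
intrinsic law, ∀-quantified over the frame `e heA hK`, the socket's `γ_H`-prefix, `β`, `y_λ`, and any v-deep literal pair `(t₀, t₁)` of the two signs), conclusion = the socket's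
body BYTE-FOR-BYTE — so skeleton v5 plugs `stub_T2G_{row}_{par}_lat := stub_T2G_{row}_{par}_lat_of_intrinsic <15 names> <the intrinsic head>`.
PROOF.  `y_λ` exists (★ `placeForm_hermitian_of_smul_eq` ⇒ `σ_w det H′_w = det H′_w` ⇒ ★ `exists_toPlace_eq_of_galAdicCompletionMap_eq`); `β` exists (★
`exists_units_toPlace_eq_symmDisc_of_deep` at `M₀ = 1`: the 2-deep tokens give `|u_w − 1|, |det g_w − 1| ≤ |ι_w ϖ_v| = |ϖ|²` (§1), `χ_g(u)_w ≠ 0` by `G`-regularity ★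
`isUnit_eval_finCharpolyTwo_of_isLocalGRegular`); (F) ★ `exists_norm_mul_favourableClass_eq_one_iff_hilbertSymbol_mul_eq_one`: `FAV ↔ (y_λ,θ)_v (β,θ)_v = 1`; case
`(y_λ,θ)_v = 1`: `hIntr` at `(tp, tm)`; case `= −1`: `hIntr` at `(tm, tp)`; the rest is sign arithmetic on abstract counts (§0, no rewriting inside the lattice counts).
HONEST LABEL: HC_CM is proved only modulo the 2 remaining named inputs (hLiu418 24832, h413 24833) until rung 0 closes; this file is bookkeeping between two currencies of the
same (Cnt2′) socket, no books consequence.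

## References
* [Rogawski1990] J. D. Rogawski, *Automorphic Representations of Unitary Groups in Three Variables*, Ann. of Math. Stud. 123 (1990): §4.9 Prop. 4.9.1 (a)(b) p. 55, Lemma 4.9.3
  p. 56 (the `κ`-signed count over the two classes); §4.3 (4.3.1)–(4.3.2) p. 43; §14.2 p. 233.
* [LabesseLanglands1979] J.-P. Labesse, R. P. Langlands, *L-indistinguishability for SL(2)*, Canad. J. Math. 31 (1979), §2 (2.1)–(2.2) (the sign character of the two classes).
* [Kottwitz1986] R. E. Kottwitz, *Base change for unit elements of Hecke algebras*, Compositio Math. 60 (1986), §3.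
* [SerreLocalFields1979] J.-P. Serre, *Local Fields*, GTM 67 (1979), Ch. V §3 (norms of principal units).
-/

set_option autoImplicit false

noncomputable section

open MeasureTheory Measure Set Filter Topology NumberField IsDedekindDomain Matrix Polynomial ValuativeRel
open Literature.NumberTheory.Automorphic Literature.NumberTheory.Automorphic.UnitaryGroup
open Literature.NumberTheory.Automorphic.IntegralReduction Literature.NumberTheory.GaloisRepresentations
open Literature.NumberTheory.NumberFields Literature.NumberTheory.QuadraticForms
open Literature.GroupTheory.SpecificGroups Literature.NumberTheory.Automorphic.UnitaryLatticeTree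
open Literature.NumberTheory.Automorphic.HermitianLattice
open scoped Matrix MatrixGroups ValuativeRel

namespace Literature.NumberTheory.Rogawski1990

/-! ## §0 Sign arithmetic on abstract counts (the lattice counts are never rewritten) -/

section Arith

/-- `A − B = b·R` with `P ↔ 1·b = 1`, `b = ±1` ⇒ the socket's pair law. [folklore] -/
private theorem pairLaw_of_intrinsic_pos {P : Prop} {A B R : ℂ} {b : ℤ} (hb : b = 1 ∨ b = -1)
    (hF : P ↔ ((1 : ℤ) : ℂ) * (b : ℂ) = 1) (hI : A - B = (b : ℂ) * R) :
    (P → A - B = R) ∧ (¬ P → A - B = -R) := by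
  rcases hb with rfl | rfl
  · exact ⟨fun _ => by rw [hI]; push_cast; ring, fun h => absurd (hF.2 (by push_cast; ring)) h⟩
  · exact ⟨fun h => absurd (hF.1 h) (by push_cast; norm_num), fun _ => by rw [hI]; push_cast; ring⟩

/-- `B − A = b·R` with `P ↔ (−1)·b = 1`, `b = ±1` ⇒ the socket's pair law. [folklore] -/
private theorem pairLaw_of_intrinsic_neg {P : Prop} {A B R : ℂ} {b : ℤ} (hb : b = 1 ∨ b = -1)
    (hF : P ↔ ((-1 : ℤ) : ℂ) * (b : ℂ) = 1) (hI : B - A = (b : ℂ) * R) :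
    (P → A - B = R) ∧ (¬ P → A - B = -R) := by
  have hBA : A - B = -(B - A) := by ring
  rcases hb with rfl | rfl
  · exact ⟨fun h => absurd (hF.1 h) (by push_cast; norm_num), fun _ => by rw [hBA, hI]; push_cast; ring⟩
  · exact ⟨fun _ => by rw [hBA, hI]; push_cast; ring, fun h => absurd (hF.2 (by push_cast; ring)) h⟩

/-- `|det g − 1| ≤ |c|` for a `2 × 2` matrix `g ≡ 1 (mod c)` entrywise, `|c| ≤ 1`. [folklore] -/
private theorem valued_det_sub_one_le_of_entrywise {K : Type*} [Field K] [Valued K (WithZero (Multiplicative ℤ))]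
    {g : Matrix (Fin 2) (Fin 2) K} {c : K} (hc : Valued.v c ≤ 1)
    (h : ∀ i j : Fin 2, Valued.v ((g - 1) i j) ≤ Valued.v c) : Valued.v (g.det - 1) ≤ Valued.v c := by
  have h00 : Valued.v (g 0 0 - 1) ≤ Valued.v c := by simpa using h 0 0
  have h11 : Valued.v (g 1 1 - 1) ≤ Valued.v c := by simpa using h 1 1
  have h01 : Valued.v (g 0 1) ≤ Valued.v c := by simpa using h 0 1
  have h10 : Valued.v (g 1 0) ≤ Valued.v c := by simpa using h 1 0
  have hcc : Valued.v c * Valued.v c ≤ Valued.v c := (mul_le_mul' hc (le_refl _)).trans_eq (one_mul _)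
  have hre : g.det - 1 = (g 0 0 - 1) * (g 1 1 - 1) + (g 0 0 - 1) + (g 1 1 - 1) - g 0 1 * g 1 0 := by
    rw [Matrix.det_fin_two]; ring
  rw [hre]
  refine le_trans (Valuation.map_sub _ _ _) (max_le ?_ ?_)
  · refine le_trans (Valuation.map_add _ _ _) (max_le ?_ h11)
    refine le_trans (Valuation.map_add _ _ _) (max_le ?_ h00)
    rw [map_mul]; exact (mul_le_mul' h00 h11).trans hcc
  · rw [map_mul]; exact (mul_le_mul' h01 h10).trans hcc

end Arith

/-! ## §1 The two symbol arguments exist: `y_λ` (`ι_w y_λ = −det H′_w`) and the symmetrised discriminant `β` of a 2-deep `G`-regular `γ_H` -/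

section Tokens

variable (L : Type) [Field L] [NumberField L] [IsCMField L] (H' : Matrix (Fin 3) (Fin 3) L) {v : HeightOneSpectrum (𝓞 ↥(maximalRealSubfield L))}
  (w : PlacesOver L v) (hw : IsCMField.complexConj L • w.1 = w.1)

include hw in
/-- **`y_λ` EXISTS**: for `H′` hermitian, `−det H′_w` is `σ_w`-fixed, hence of the form `ι_w y_λ` with `y_λ ∈ L⁺_v`. [cite: Rogawski1990, §4.9 Prop. 4.9.1 p. 55; §4.3 (4.3.2) p. 43] -/
theorem exists_toPlace_eq_neg_det_placeForm (hH' : (H'.map (cmConjRingHom L)).transpose = H') :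
    ∃ yl : v.adicCompletion ↥(maximalRealSubfield L), toPlace v w yl = -(placeForm H' w.1).det := by
  have hc1 : IsCMField.complexConj L ≠ 1 := IsCMField.complexConj_ne_one L
  have hσa : galAdicCompletionMap (L := L) (IsCMField.complexConj L) hw (-(placeForm H' w.1).det) = -(placeForm H' w.1).det := by
    haveI : Algebra.IsQuadraticExtension ↥(maximalRealSubfield L) L := IsCMField.isQuadraticExtension L
    have hh := placeForm_hermitian_of_smul_eq (IsCMField.complexConj L) w H' hH' hw
    have hdet := congrArg Matrix.det hh
    rw [Matrix.det_transpose, ← RingHom.mapMatrix_apply, ← RingHom.map_det] at hdet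
    rw [map_neg, hdet]
  exact exists_toPlace_eq_of_galAdicCompletionMap_eq (IsCMField.complexConj L) w hc1 hw _ hσa

include hw in
set_option maxHeartbeats 800000 in
-- budget only: statement-heavy CM-place tokens.
/-- **THE SYMMETRISED DISCRIMINANT `β ∈ (L⁺_v)ˣ` EXISTS ON THE 2-DEEP TUBE**: at a ramified `w ∣ v` with `|2|_w = 1`, for `γ_H = (g, u)` with `g_w ≡ 1`, `u_w ≡ 1 (mod ϖ²)`
(`|ϖ|² = |ι_w ϖ_v|`) and `G`-regular (`χ_g(u)_w ≠ 0`), `ι_w β = −χ_g(u)_w (u_w² + det g_w) ∕ (2 u_w² det g_w)` for some unit `β` (★ `exists_units_toPlace_eq_symmDisc_of_deep`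
at `M₀ = 1`). [cite: Rogawski1990, §4.9 p. 55, Lemma 4.9.3 p. 56] [cite: LabesseLanglands1979, §2 (2.1)] -/
theorem exists_units_toPlace_eq_symmDisc_of_twoDeep (he : v.asIdeal.ramificationIdx' w.1.asIdeal ≠ 1) (h2 : IsUnit (2 : 𝒪[(w.1.adicCompletion L)]))
    (ϖ : w.1.adicCompletion L) (hϖ : Valued.v ϖ = WithZero.exp (-1 : ℤ))
    {γH : ((cmDatum L 2 (Matrix.of fun i j : Fin 2 => if i.val + j.val + 1 = 2 then (1 : L) else 0)).Local v × (cmDatum L 1 (Matrix.of fun i j : Fin 1 => if i.val + j.val + 1 = 1 then (1 : L) else 0)).Local v)}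
    (hblk : ∀ i j : Fin 2, Valued.v (((((γH.1.val : GL (Fin 2) (UnitaryGroup.LocalRing L v)).val.map (Pi.evalRingHom (fun w' : PlacesOver L v => w'.1.adicCompletion L) w))) - 1) i j) ≤ Valued.v (ϖ ^ 2))
    (hu2 : Valued.v (finGammaTwo L v γH w - 1) ≤ Valued.v (ϖ ^ 2)) (hreg : IsLocalGRegular L v γH) :
    ∃ β : (v.adicCompletion ↥(maximalRealSubfield L))ˣ, toPlace v w (β : v.adicCompletion ↥(maximalRealSubfield L)) =
          -(((finCharpolyTwo L v γH).eval (finGammaTwo L v γH)) w *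
              (finGammaTwo L v γH w ^ 2 +
                ((γH.1.val.val : Matrix (Fin 2) (Fin 2) (LocalRing L v)).map (Pi.evalRingHom (fun w' : PlacesOver L v => w'.1.adicCompletion L) w)).det)) /
            (2 * finGammaTwo L v γH w ^ 2 *
              ((γH.1.val.val : Matrix (Fin 2) (Fin 2) (LocalRing L v)).map (Pi.evalRingHom (fun w' : PlacesOver L v => w'.1.adicCompletion L) w)).det) := by
  have hc1 : IsCMField.complexConj L ≠ 1 := IsCMField.complexConj_ne_one L
  have h2v : Valued.v (2 : w.1.adicCompletion L) = 1 := (isUnit_two_integer_iff_valued_eq_one L w.1).1 h2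
  have hχ0 : ((finCharpolyTwo L v γH).eval (finGammaTwo L v γH)) w ≠ 0 :=
    ((isUnit_eval_finCharpolyTwo_of_isLocalGRegular L v γH hreg).map (Pi.evalRingHom (fun w' : PlacesOver L v => w'.1.adicCompletion L) w)).ne_zero
  have hP : Valued.v ((toPlace v w (HeckeCharacter.uniformizer ↥(maximalRealSubfield L) v : v.adicCompletion ↥(maximalRealSubfield L))) ^ 1) = Valued.v (ϖ ^ 2) := by
    rw [pow_one, (valued_toPlace_uniformizer_of_ramified L (IsCMField.complexConj L) hc1 w hw he).1, map_pow, hϖ, ← WithZero.exp_nsmul]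
    norm_num
  have hϖ2 : Valued.v (ϖ ^ 2) ≤ 1 := by
    rw [map_pow, hϖ, ← WithZero.exp_nsmul, ← WithZero.exp_zero, WithZero.exp_le_exp]; norm_num
  have hud : Valued.v (finGammaTwo L v γH w - 1) ≤
      Valued.v ((toPlace v w (HeckeCharacter.uniformizer ↥(maximalRealSubfield L) v : v.adicCompletion ↥(maximalRealSubfield L))) ^ 1) := by
    rw [hP]; exact hu2
  have hdd : Valued.v (((γH.1.val.val : Matrix (Fin 2) (Fin 2) (LocalRing L v)).map (Pi.evalRingHom (fun w' : PlacesOver L v => w'.1.adicCompletion L) w)).det - 1) ≤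
      Valued.v ((toPlace v w (HeckeCharacter.uniformizer ↥(maximalRealSubfield L) v : v.adicCompletion ↥(maximalRealSubfield L))) ^ 1) := by
    rw [hP]; exact valued_det_sub_one_le_of_entrywise hϖ2 hblk
  exact exists_units_toPlace_eq_symmDisc_of_deep L v w hw h2v le_rfl γH hχ0 hud hdd

end Tokens

/-! ## §2 The wrappers: socket ⟸ intrinsic law -/

section Wrappers

set_option maxHeartbeats 3200000 in
-- budget only: the statement is two copies of the chair's socket text (statement-heavy CM-place tokens); the proof is short.
/-- **SOCKET `stub_T2G_zero_even_lat` ⟸ INTRINSIC LAW** (row `0` (`LEV ϖ²`), even discriminant depth): the chair's socket text (15 binders + body VERBATIM,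
`F0/P3a/F0P3a-p07/g14/cnt2/socket-T2G_zero_lat_even.F0P3ap07g14.txt`) from ONE hypothesis `hIntr` = the same frame∕`γ_H`-prefix followed by
`∀ β (hβ : ι_w β = −χ_g(u)_w(u_w²+det g_w)∕(2u_w² det g_w)) yl (hyl : ι_w yl = −det H′_w) t₀ t₁` (matches of signs `κ(t₀) = (yl,θ)_v`, `κ(t₁) = −(yl,θ)_v`, both v-deep)
`⊢ S_j(t₀) − S_j(t₁) = (β,θ)_v · (q^m · X̃_j(n))`.  [cite: Rogawski1990, §4.9 Prop. 4.9.1 (a)(b) p. 55, Lemma 4.9.3 p. 56; §4.3 (4.3.2) p. 43; §14.2 p. 233] [cite: LabesseLanglands1979, §2 (2.1)–(2.2)] [cite: Kottwitz1986, §3] -/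
theorem stub_T2G_zero_even_lat_of_intrinsic
    (L : Type) [Field L] [NumberField L] [IsCMField L] (H' : Matrix (Fin 3) (Fin 3) L)
    {v : HeightOneSpectrum (𝓞 ↥(maximalRealSubfield L))}
    (hH' : (H'.map (cmConjRingHom L)).transpose = H') (w : PlacesOver L v)
    (hw : IsCMField.complexConj L • w.1 = w.1) (he : v.asIdeal.ramificationIdx' w.1.asIdeal ≠ 1)
    (hH'w : IsUnit (placeForm H' w.1)) (_hH'i : hH'w.unit ∈ glInt 3 (w.1.adicCompletion L))
    (h2 : IsUnit (2 : 𝒪[(w.1.adicCompletion L)]))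
    (ϖ : w.1.adicCompletion L) (hϖ : Valued.v ϖ = WithZero.exp (-1 : ℤ)) (_hσϖ : galAdicCompletionMap (L := L) (IsCMField.complexConj L) hw ϖ = -ϖ)
    (A : GL (Fin 3) (w.1.adicCompletion L)) (_hA : A ∈ glInt 3 (w.1.adicCompletion L))
    (_hframe : placeForm H' w.1 = (-(placeForm H' w.1).det) • formCongr (galAdicCompletionMap (L := L) (IsCMField.complexConj L) hw) A ((StdForm.antidiagonal 3).over (w.1.adicCompletion L)))
    (hIntr :     ∀ (e : ↥(UnitaryGroup.«local» L (IsCMField.complexConj L) 3 H' v) ≃ₜ* ↥(unitaryGroupOfForm (galAdicCompletionMap (L := L) (IsCMField.complexConj L) hw) (placeForm (Matrix.of fun i j : Fin 3 => if i.val + j.val + 1 = 3 then (1 : L) else 0) w.1)))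
      (heA : ∀ g : ((cmDatum L 3 H').Local v), (((e g) : ↥(unitaryGroupOfForm (galAdicCompletionMap (L := L) (IsCMField.complexConj L) hw) (placeForm (Matrix.of fun i j : Fin 3 => if i.val + j.val + 1 = 3 then (1 : L) else 0) w.1))) : GL (Fin 3) (w.1.adicCompletion L)) =
        A * ((localNonsplitEquiv (IsCMField.complexConj L) H' (IsCMField.complexConj_ne_one L) w hw g).val : GL (Fin 3) (w.1.adicCompletion L)) * A⁻¹)
      (hK : ∀ g : ((cmDatum L 3 H').Local v), g ∈ (cmLocalIntegralLevel L 3 H' v) ↔ (((e g) : ↥(unitaryGroupOfForm (galAdicCompletionMap (L := L) (IsCMField.complexConj L) hw) (placeForm (Matrix.of fun i j : Fin 3 => if i.val + j.val + 1 = 3 then (1 : L) else 0) w.1))) : GL (Fin 3) (w.1.adicCompletion L)) ∈ glInt 3 (w.1.adicCompletion L)),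
      ∀ ⦃γH : ((cmDatum L 2 (Matrix.of fun i j : Fin 2 => if i.val + j.val + 1 = 2 then (1 : L) else 0)).Local v × (cmDatum L 1 (Matrix.of fun i j : Fin 1 => if i.val + j.val + 1 = 1 then (1 : L) else 0)).Local v)⦄,
      (∀ i j : Fin 2, Valued.v (((((γH.1.val : GL (Fin 2) (UnitaryGroup.LocalRing L v)).val.map (Pi.evalRingHom (fun w' : PlacesOver L v => w'.1.adicCompletion L) w))) - 1) i j) ≤ Valued.v (ϖ ^ 2)) → Valued.v (finGammaTwo L v γH w - 1) ≤ Valued.v (ϖ ^ 2) → IsLocalGRegular L v γH →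
      (¬ ∃ x : (w.1.adicCompletion L), ((((γH.1.val : GL (Fin 2) (UnitaryGroup.LocalRing L v)).val.map (Pi.evalRingHom (fun w' : PlacesOver L v => w'.1.adicCompletion L) w))).charpoly).IsRoot x) → ∀ ⦃n : ℕ⦄,
      Valued.v ((((γH.1.val : GL (Fin 2) (UnitaryGroup.LocalRing L v)).val.map (Pi.evalRingHom (fun w' : PlacesOver L v => w'.1.adicCompletion L) w))).trace ^ 2 - 4 * (((γH.1.val : GL (Fin 2) (UnitaryGroup.LocalRing L v)).val.map (Pi.evalRingHom (fun w' : PlacesOver L v => w'.1.adicCompletion L) w))).det) = WithZero.exp (-((2 * (2 * n) : ℕ) : ℤ)) → 1 ≤ n →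
      ∀ (m : ℕ), Valued.v (((finCharpolyTwo L v γH).eval (finGammaTwo L v γH)) w) =
          Valued.v ((toPlace v w (HeckeCharacter.uniformizer ↥(maximalRealSubfield L) v : v.adicCompletion ↥(maximalRealSubfield L))) ^ m) →
        ∀ β : (v.adicCompletion ↥(maximalRealSubfield L))ˣ, toPlace v w (β : v.adicCompletion ↥(maximalRealSubfield L)) =
          -(((finCharpolyTwo L v γH).eval (finGammaTwo L v γH)) w *
              (finGammaTwo L v γH w ^ 2 +
                ((γH.1.val.val : Matrix (Fin 2) (Fin 2) (LocalRing L v)).map (Pi.evalRingHom (fun w' : PlacesOver L v => w'.1.adicCompletion L) w)).det)) /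
            (2 * finGammaTwo L v γH w ^ 2 *
              ((γH.1.val.val : Matrix (Fin 2) (Fin 2) (LocalRing L v)).map (Pi.evalRingHom (fun w' : PlacesOver L v => w'.1.adicCompletion L) w)).det) →
        ∀ yl : v.adicCompletion ↥(maximalRealSubfield L), toPlace v w yl = -(placeForm H' w.1).det →
        ∀ t₀ t₁ : ((cmDatum L 3 H').Local v), IsLocalNormPair L H' v γH t₀ → IsLocalNormPair L H' v γH t₁ →
        finKappaAt L v H' γH t₀ = hilbertSymbol (v.adicCompletion ↥(maximalRealSubfield L)) yl (algebraMap ↥(maximalRealSubfield L) _ ((cmQuadraticGenerator L : 𝓞 ↥(maximalRealSubfield L)) : ↥(maximalRealSubfield L))) → finKappaAt L v H' γH t₁ = -hilbertSymbol (v.adicCompletion ↥(maximalRealSubfield L)) yl (algebraMap ↥(maximalRealSubfield L) _ ((cmQuadraticGenerator L : 𝓞 ↥(maximalRealSubfield L)) : ↥(maximalRealSubfield L))) →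
        (∀ a b, Valued.v (((toPlace v w (HeckeCharacter.uniformizer ↥(maximalRealSubfield L) v : v.adicCompletion ↥(maximalRealSubfield L))) ^ 1)⁻¹ * ((((t₀).val : GL (Fin 3) (UnitaryGroup.LocalRing L v)).val.map (Pi.evalRingHom (fun w' : PlacesOver L v => w'.1.adicCompletion L) w)) a b - (1 : Matrix (Fin 3) (Fin 3) (w.1.adicCompletion L)) a b)) ≤ 1) → (∀ a b, Valued.v (((toPlace v w (HeckeCharacter.uniformizer ↥(maximalRealSubfield L) v : v.adicCompletion ↥(maximalRealSubfield L))) ^ 1)⁻¹ * ((((t₁).val : GL (Fin 3) (UnitaryGroup.LocalRing L v)).val.map (Pi.evalRingHom (fun w' : PlacesOver L v => w'.1.adicCompletion L) w)) a b - (1 : Matrix (Fin 3) (Fin 3) (w.1.adicCompletion L)) a b)) ≤ 1) →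
          ({M : Submodule (Valued.integer (w.1.adicCompletion L)) (Fin 3 → (w.1.adicCompletion L)) | IsSelfDualLattice (galAdicCompletionMap (L := L) (IsCMField.complexConj L) hw) ϖ (placeForm (Matrix.of fun i j : Fin 3 => if i.val + j.val + 1 = 3 then (1 : L) else 0) w.1) M ∧ mapGL ((e t₀ : ↥(unitaryGroupOfForm (galAdicCompletionMap (L := L) (IsCMField.complexConj L) hw) (placeForm (Matrix.of fun i j : Fin 3 => if i.val + j.val + 1 = 3 then (1 : L) else 0) w.1))) : GL (Fin 3) (w.1.adicCompletion L)) M = M ∧ M.map ((Matrix.toLin' ((((e t₀ : ↥(unitaryGroupOfForm (galAdicCompletionMap (L := L) (IsCMField.complexConj L) hw) (placeForm (Matrix.of fun i j : Fin 3 => if i.val + j.val + 1 = 3 then (1 : L) else 0) w.1))) : GL (Fin 3) (w.1.adicCompletion L)) : Matrix (Fin 3) (Fin 3) (w.1.adicCompletion L)) - 1)).restrictScalars (Valued.integer (w.1.adicCompletion L))) ≤ scaleLattice (ϖ ^ 2) M}.ncard : ℂ) - ({M : Submodule (Valued.integer (w.1.adicCompletion L)) (Fin 3 → (w.1.adicCompletion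 L)) | IsSelfDualLattice (galAdicCompletionMap (L := L) (IsCMField.complexConj L) hw) ϖ (placeForm (Matrix.of fun i j : Fin 3 => if i.val + j.val + 1 = 3 then (1 : L) else 0) w.1) M ∧ mapGL ((e t₁ : ↥(unitaryGroupOfForm (galAdicCompletionMap (L := L) (IsCMField.complexConj L) hw) (placeForm (Matrix.of fun i j : Fin 3 => if i.val + j.val + 1 = 3 then (1 : L) else 0) w.1))) : GL (Fin 3) (w.1.adicCompletion L)) M = M ∧ M.map ((Matrix.toLin' ((((e t₁ : ↥(unitaryGroupOfForm (galAdicCompletionMap (L := L) (IsCMField.complexConj L) hw) (placeForm (Matrix.of fun i j : Fin 3 => if i.val + j.val + 1 = 3 then (1 : L) else 0) w.1))) : GL (Fin 3) (w.1.adicCompletion L)) : Matrix (Fin 3) (Fin 3) (w.1.adicCompletion L)) - 1)).restrictScalars (Valued.integer (w.1.adicCompletion L))) ≤ scaleLattice (ϖ ^ 2) M}.ncard : ℂ) = ((hilbertSymbol (v.adicCompletion ↥(maximalRealSubfield L)) (β : v.adicCompletion ↥(maximalRealSubfield L)) (algebraMap ↥(maximalRealSubfield L) _ ((cmQuadraticGenerator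 L : 𝓞 ↥(maximalRealSubfield L)) : ↥(maximalRealSubfield L))) : ℤ) : ℂ) * ((Ideal.absNorm v.asIdeal : ℂ) ^ m * (((((Ideal.absNorm v.asIdeal : ℂ) + 1) * ∑ k ∈ Finset.range n, (Ideal.absNorm v.asIdeal : ℂ) ^ k) - 1) / (Ideal.absNorm v.asIdeal : ℂ) ^ 3))) :
        ∀ (e : ↥(UnitaryGroup.«local» L (IsCMField.complexConj L) 3 H' v) ≃ₜ* ↥(unitaryGroupOfForm (galAdicCompletionMap (L := L) (IsCMField.complexConj L) hw) (placeForm (Matrix.of fun i j : Fin 3 => if i.val + j.val + 1 = 3 then (1 : L) else 0) w.1)))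
      (heA : ∀ g : ((cmDatum L 3 H').Local v), (((e g) : ↥(unitaryGroupOfForm (galAdicCompletionMap (L := L) (IsCMField.complexConj L) hw) (placeForm (Matrix.of fun i j : Fin 3 => if i.val + j.val + 1 = 3 then (1 : L) else 0) w.1))) : GL (Fin 3) (w.1.adicCompletion L)) =
        A * ((localNonsplitEquiv (IsCMField.complexConj L) H' (IsCMField.complexConj_ne_one L) w hw g).val : GL (Fin 3) (w.1.adicCompletion L)) * A⁻¹)
      (hK : ∀ g : ((cmDatum L 3 H').Local v), g ∈ (cmLocalIntegralLevel L 3 H' v) ↔ (((e g) : ↥(unitaryGroupOfForm (galAdicCompletionMap (L := L) (IsCMField.complexConj L) hw) (placeForm (Matrix.of fun i j : Fin 3 => if i.val + j.val + 1 = 3 then (1 : L) else 0) w.1))) : GL (Fin 3) (w.1.adicCompletion L)) ∈ glInt 3 (w.1.adicCompletion L)),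
      ∀ ⦃γH : ((cmDatum L 2 (Matrix.of fun i j : Fin 2 => if i.val + j.val + 1 = 2 then (1 : L) else 0)).Local v × (cmDatum L 1 (Matrix.of fun i j : Fin 1 => if i.val + j.val + 1 = 1 then (1 : L) else 0)).Local v)⦄,
      (∀ i j : Fin 2, Valued.v (((((γH.1.val : GL (Fin 2) (UnitaryGroup.LocalRing L v)).val.map (Pi.evalRingHom (fun w' : PlacesOver L v => w'.1.adicCompletion L) w))) - 1) i j) ≤ Valued.v (ϖ ^ 2)) → Valued.v (finGammaTwo L v γH w - 1) ≤ Valued.v (ϖ ^ 2) → IsLocalGRegular L v γH →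
      (¬ ∃ x : (w.1.adicCompletion L), ((((γH.1.val : GL (Fin 2) (UnitaryGroup.LocalRing L v)).val.map (Pi.evalRingHom (fun w' : PlacesOver L v => w'.1.adicCompletion L) w))).charpoly).IsRoot x) → ∀ ⦃n : ℕ⦄,
      Valued.v ((((γH.1.val : GL (Fin 2) (UnitaryGroup.LocalRing L v)).val.map (Pi.evalRingHom (fun w' : PlacesOver L v => w'.1.adicCompletion L) w))).trace ^ 2 - 4 * (((γH.1.val : GL (Fin 2) (UnitaryGroup.LocalRing L v)).val.map (Pi.evalRingHom (fun w' : PlacesOver L v => w'.1.adicCompletion L) w))).det) = WithZero.exp (-((2 * (2 * n) : ℕ) : ℤ)) → 1 ≤ n →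
      ∀ (m : ℕ), Valued.v (((finCharpolyTwo L v γH).eval (finGammaTwo L v γH)) w) =
          Valued.v ((toPlace v w (HeckeCharacter.uniformizer ↥(maximalRealSubfield L) v : v.adicCompletion ↥(maximalRealSubfield L))) ^ m) →
        ∀ tp tm : ((cmDatum L 3 H').Local v), IsLocalNormPair L H' v γH tp → IsLocalNormPair L H' v γH tm → finKappaAt L v H' γH tp = 1 → finKappaAt L v H' γH tm = -1 →
        (∀ a b, Valued.v (((toPlace v w (HeckeCharacter.uniformizer ↥(maximalRealSubfield L) v : v.adicCompletion ↥(maximalRealSubfield L))) ^ 1)⁻¹ * ((((tp).val : GL (Fin 3) (UnitaryGroup.LocalRing L v)).val.map (Pi.evalRingHom (fun w' : PlacesOver L v => w'.1.adicCompletion L) w)) a b - (1 : Matrix (Fin 3) (Fin 3) (w.1.adicCompletion L)) a b)) ≤ 1) → (∀ a b, Valued.v (((toPlace v w (HeckeCharacter.uniformizer ↥(maximalRealSubfield L) v : v.adicCompletion ↥(maximalRealSubfield L))) ^ 1)⁻¹ * ((((tm).val : GL (Fin 3) (UnitaryGroup.LocalRing L v)).val.map (Pi.evalRingHom (fun w'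 : PlacesOver L v => w'.1.adicCompletion L) w)) a b - (1 : Matrix (Fin 3) (Fin 3) (w.1.adicCompletion L)) a b)) ≤ 1) →
        (((∃ z : (w.1.adicCompletion L), z * galAdicCompletionMap (L := L) (IsCMField.complexConj L) hw z *
          ((placeForm H' w.1).det * ((finCharpolyTwo L v γH).eval (finGammaTwo L v γH)) w /
            ((1 + finGammaTwo L v γH w) ^ 2 * (1 + ((γH.1.val.val : Matrix (Fin 2) (Fin 2) (LocalRing L v)).map (Pi.evalRingHom (fun w' : PlacesOver L v => w'.1.adicCompletion L) w)).trace + ((γH.1.val.val : Matrix (Fin 2) (Fin 2) (LocalRing L v)).map (Pi.evalRingHom (fun w' : PlacesOver L v => w'.1.adicCompletion L) w)).det))) = 1) →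
          ({M : Submodule (Valued.integer (w.1.adicCompletion L)) (Fin 3 → (w.1.adicCompletion L)) | IsSelfDualLattice (galAdicCompletionMap (L := L) (IsCMField.complexConj L) hw) ϖ (placeForm (Matrix.of fun i j : Fin 3 => if i.val + j.val + 1 = 3 then (1 : L) else 0) w.1) M ∧ mapGL ((e tp : ↥(unitaryGroupOfForm (galAdicCompletionMap (L := L) (IsCMField.complexConj L) hw) (placeForm (Matrix.of fun i j : Fin 3 => if i.val + j.val + 1 = 3 then (1 : L) else 0) w.1))) : GL (Fin 3) (w.1.adicCompletion L)) M = M ∧ M.map ((Matrix.toLin' ((((e tp : ↥(unitaryGroupOfForm (galAdicCompletionMap (L := L) (IsCMField.complexConj L) hw) (placeForm (Matrix.of fun i j : Fin 3 => if i.val + j.val + 1 = 3 then (1 : L) else 0) w.1))) : GL (Fin 3) (w.1.adicCompletion L)) : Matrix (Fin 3) (Fin 3) (w.1.adicCompletion L)) - 1)).restrictScalars (Valued.integer (w.1.adicCompletion L))) ≤ scaleLattice (ϖ ^ 2) M}.ncard : ℂ) - ({M : Submodule (Valued.integer (w.1.adicCompletion L)) (Fin 3 → (w.1.adicCompletion L))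 | IsSelfDualLattice (galAdicCompletionMap (L := L) (IsCMField.complexConj L) hw) ϖ (placeForm (Matrix.of fun i j : Fin 3 => if i.val + j.val + 1 = 3 then (1 : L) else 0) w.1) M ∧ mapGL ((e tm : ↥(unitaryGroupOfForm (galAdicCompletionMap (L := L) (IsCMField.complexConj L) hw) (placeForm (Matrix.of fun i j : Fin 3 => if i.val + j.val + 1 = 3 then (1 : L) else 0) w.1))) : GL (Fin 3) (w.1.adicCompletion L)) M = M ∧ M.map ((Matrix.toLin' ((((e tm : ↥(unitaryGroupOfForm (galAdicCompletionMap (L := L) (IsCMField.complexConj L) hw) (placeForm (Matrix.of fun i j : Fin 3 => if i.val + j.val + 1 = 3 then (1 : L) else 0) w.1))) : GL (Fin 3) (w.1.adicCompletion L)) : Matrix (Fin 3) (Fin 3) (w.1.adicCompletion L)) - 1)).restrictScalars (Valued.integer (w.1.adicCompletion L))) ≤ scaleLattice (ϖ ^ 2) M}.ncard : ℂ) = (Ideal.absNorm v.asIdeal : ℂ) ^ m * (((((Ideal.absNorm v.asIdeal : ℂ) + 1) * ∑ k ∈ Finset.range n, (Ideal.absNorm v.asIdeal : ℂ) ^ k)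 - 1) / (Ideal.absNorm v.asIdeal : ℂ) ^ 3)) ∧
        (¬ (∃ z : (w.1.adicCompletion L), z * galAdicCompletionMap (L := L) (IsCMField.complexConj L) hw z *
          ((placeForm H' w.1).det * ((finCharpolyTwo L v γH).eval (finGammaTwo L v γH)) w /
            ((1 + finGammaTwo L v γH w) ^ 2 * (1 + ((γH.1.val.val : Matrix (Fin 2) (Fin 2) (LocalRing L v)).map (Pi.evalRingHom (fun w' : PlacesOver L v => w'.1.adicCompletion L) w)).trace + ((γH.1.val.val : Matrix (Fin 2) (Fin 2) (LocalRing L v)).map (Pi.evalRingHom (fun w' : PlacesOver L v => w'.1.adicCompletion L) w)).det))) = 1) →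
          ({M : Submodule (Valued.integer (w.1.adicCompletion L)) (Fin 3 → (w.1.adicCompletion L)) | IsSelfDualLattice (galAdicCompletionMap (L := L) (IsCMField.complexConj L) hw) ϖ (placeForm (Matrix.of fun i j : Fin 3 => if i.val + j.val + 1 = 3 then (1 : L) else 0) w.1) M ∧ mapGL ((e tp : ↥(unitaryGroupOfForm (galAdicCompletionMap (L := L) (IsCMField.complexConj L) hw) (placeForm (Matrix.of fun i j : Fin 3 => if i.val + j.val + 1 = 3 then (1 : L) else 0) w.1))) : GL (Fin 3) (w.1.adicCompletion L)) M = M ∧ M.map ((Matrix.toLin' ((((e tp : ↥(unitaryGroupOfForm (galAdicCompletionMap (L := L) (IsCMField.complexConj L) hw) (placeForm (Matrix.of fun i j : Fin 3 => if i.val + j.val + 1 = 3 then (1 : L) else 0) w.1))) : GL (Fin 3) (w.1.adicCompletion L)) : Matrix (Fin 3) (Fin 3) (w.1.adicCompletion L)) - 1)).restrictScalars (Valued.integer (w.1.adicCompletion L))) ≤ scaleLattice (ϖ ^ 2) M}.ncard : ℂ) - ({M : Submodule (Valued.integer (w.1.adicCompletion L)) (Fin 3 → (w.1.adicCompletion L))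 | IsSelfDualLattice (galAdicCompletionMap (L := L) (IsCMField.complexConj L) hw) ϖ (placeForm (Matrix.of fun i j : Fin 3 => if i.val + j.val + 1 = 3 then (1 : L) else 0) w.1) M ∧ mapGL ((e tm : ↥(unitaryGroupOfForm (galAdicCompletionMap (L := L) (IsCMField.complexConj L) hw) (placeForm (Matrix.of fun i j : Fin 3 => if i.val + j.val + 1 = 3 then (1 : L) else 0) w.1))) : GL (Fin 3) (w.1.adicCompletion L)) M = M ∧ M.map ((Matrix.toLin' ((((e tm : ↥(unitaryGroupOfForm (galAdicCompletionMap (L := L) (IsCMField.complexConj L) hw) (placeForm (Matrix.of fun i j : Fin 3 => if i.val + j.val + 1 = 3 then (1 : L) else 0) w.1))) : GL (Fin 3) (w.1.adicCompletion L)) : Matrix (Fin 3) (Fin 3) (w.1.adicCompletion L)) - 1)).restrictScalars (Valued.integer (w.1.adicCompletion L))) ≤ scaleLattice (ϖ ^ 2) M}.ncard : ℂ) = -((Ideal.absNorm v.asIdeal : ℂ) ^ m * (((((Ideal.absNorm v.asIdeal : ℂ) + 1) * ∑ k ∈ Finset.range n, (Ideal.absNorm v.asIdeal : ℂ) ^ k)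 - 1) / (Ideal.absNorm v.asIdeal : ℂ) ^ 3)))) := by
  intro e heA hK γH hblk hu2 hreg hirr n hdisc hn m hm tp tm htp htm hκp hκm hdp hdm
  obtain ⟨yl, hyl⟩ := exists_toPlace_eq_neg_det_placeForm L H' w hw hH'
  obtain ⟨β, hβ⟩ := exists_units_toPlace_eq_symmDisc_of_twoDeep L w hw he h2 ϖ hϖ hblk hu2 hreg
  have hF := exists_norm_mul_favourableClass_eq_one_iff_hilbertSymbol_mul_eq_one L H' w hw he hH'w h2 ϖ hϖ hblk hu2 hreg β hβ yl hyl
  have hb := hilbertSymbol_eq_one_or_eq_neg_one (F := v.adicCompletion ↥(maximalRealSubfield L)) (β : v.adicCompletion ↥(maximalRealSubfield L)) (algebraMap ↥(maximalRealSubfield L) _ ((cmQuadraticGenerator L : 𝓞 ↥(maximalRealSubfield L)) : ↥(maximalRealSubfield L)))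
  rcases hilbertSymbol_eq_one_or_eq_neg_one (F := v.adicCompletion ↥(maximalRealSubfield L)) yl (algebraMap ↥(maximalRealSubfield L) _ ((cmQuadraticGenerator L : 𝓞 ↥(maximalRealSubfield L)) : ↥(maximalRealSubfield L))) with hy | hy
  · have hI := hIntr e heA hK hblk hu2 hreg hirr hdisc hn m hm β hβ yl hyl tp tm htp htm (by rw [hκp, hy]) (by rw [hκm, hy]) hdp hdm
    rw [hy] at hF
    exact pairLaw_of_intrinsic_pos hb hF hI
  · have hI := hIntr e heA hK hblk hu2 hreg hirr hdisc hn m hm β hβ yl hyl tm tp htm htp (by rw [hκm, hy]) (by rw [hκp, hy]; norm_num) hdm hdp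
    rw [hy] at hF
    exact pairLaw_of_intrinsic_neg hb hF hI

set_option maxHeartbeats 3200000 in
-- budget only: the statement is two copies of the chair's socket text (statement-heavy CM-place tokens); the proof is short.
/-- **SOCKET `stub_T2G_zero_odd_lat` ⟸ INTRINSIC LAW** (row `0` (`LEV ϖ²`), odd discriminant depth): the chair's socket text (15 binders + body VERBATIM,
`F0/P3a/F0P3a-p07/g14/cnt2/socket-T2G_zero_lat_odd.F0P3ap07g14.txt`) from ONE hypothesis `hIntr` = the same frame∕`γ_H`-prefix followed by
`∀ β (hβ : ι_w β = −χ_g(u)_w(u_w²+det g_w)∕(2u_w² det g_w)) yl (hyl : ι_w yl = −det H′_w) t₀ t₁` (matches of signs `κ(t₀) = (yl,θ)_v`, `κ(t₁) = −(yl,θ)_v`, both v-deep)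
`⊢ S_j(t₀) − S_j(t₁) = (β,θ)_v · (q^m · X̃_j(n))`.  [cite: Rogawski1990, §4.9 Prop. 4.9.1 (a)(b) p. 55, Lemma 4.9.3 p. 56; §4.3 (4.3.2) p. 43; §14.2 p. 233] [cite: LabesseLanglands1979, §2 (2.1)–(2.2)] [cite: Kottwitz1986, §3] -/
theorem stub_T2G_zero_odd_lat_of_intrinsic
    (L : Type) [Field L] [NumberField L] [IsCMField L] (H' : Matrix (Fin 3) (Fin 3) L)
    {v : HeightOneSpectrum (𝓞 ↥(maximalRealSubfield L))}
    (hH' : (H'.map (cmConjRingHom L)).transpose = H') (w : PlacesOver L v)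
    (hw : IsCMField.complexConj L • w.1 = w.1) (he : v.asIdeal.ramificationIdx' w.1.asIdeal ≠ 1)
    (hH'w : IsUnit (placeForm H' w.1)) (_hH'i : hH'w.unit ∈ glInt 3 (w.1.adicCompletion L))
    (h2 : IsUnit (2 : 𝒪[(w.1.adicCompletion L)]))
    (ϖ : w.1.adicCompletion L) (hϖ : Valued.v ϖ = WithZero.exp (-1 : ℤ)) (_hσϖ : galAdicCompletionMap (L := L) (IsCMField.complexConj L) hw ϖ = -ϖ)
    (A : GL (Fin 3) (w.1.adicCompletion L)) (_hA : A ∈ glInt 3 (w.1.adicCompletion L))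
    (_hframe : placeForm H' w.1 = (-(placeForm H' w.1).det) • formCongr (galAdicCompletionMap (L := L) (IsCMField.complexConj L) hw) A ((StdForm.antidiagonal 3).over (w.1.adicCompletion L)))
    (hIntr :     ∀ (e : ↥(UnitaryGroup.«local» L (IsCMField.complexConj L) 3 H' v) ≃ₜ* ↥(unitaryGroupOfForm (galAdicCompletionMap (L := L) (IsCMField.complexConj L) hw) (placeForm (Matrix.of fun i j : Fin 3 => if i.val + j.val + 1 = 3 then (1 : L) else 0) w.1)))
      (heA : ∀ g : ((cmDatum L 3 H').Local v), (((e g) : ↥(unitaryGroupOfForm (galAdicCompletionMap (L := L) (IsCMField.complexConj L) hw) (placeForm (Matrix.of fun i j : Fin 3 => if i.val + j.val + 1 = 3 then (1 : L) else 0) w.1))) : GL (Fin 3) (w.1.adicCompletion L)) =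
        A * ((localNonsplitEquiv (IsCMField.complexConj L) H' (IsCMField.complexConj_ne_one L) w hw g).val : GL (Fin 3) (w.1.adicCompletion L)) * A⁻¹)
      (hK : ∀ g : ((cmDatum L 3 H').Local v), g ∈ (cmLocalIntegralLevel L 3 H' v) ↔ (((e g) : ↥(unitaryGroupOfForm (galAdicCompletionMap (L := L) (IsCMField.complexConj L) hw) (placeForm (Matrix.of fun i j : Fin 3 => if i.val + j.val + 1 = 3 then (1 : L) else 0) w.1))) : GL (Fin 3) (w.1.adicCompletion L)) ∈ glInt 3 (w.1.adicCompletion L)),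
      ∀ ⦃γH : ((cmDatum L 2 (Matrix.of fun i j : Fin 2 => if i.val + j.val + 1 = 2 then (1 : L) else 0)).Local v × (cmDatum L 1 (Matrix.of fun i j : Fin 1 => if i.val + j.val + 1 = 1 then (1 : L) else 0)).Local v)⦄,
      (∀ i j : Fin 2, Valued.v (((((γH.1.val : GL (Fin 2) (UnitaryGroup.LocalRing L v)).val.map (Pi.evalRingHom (fun w' : PlacesOver L v => w'.1.adicCompletion L) w))) - 1) i j) ≤ Valued.v (ϖ ^ 2)) → Valued.v (finGammaTwo L v γH w - 1) ≤ Valued.v (ϖ ^ 2) → IsLocalGRegular L v γH →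
      (¬ ∃ x : (w.1.adicCompletion L), ((((γH.1.val : GL (Fin 2) (UnitaryGroup.LocalRing L v)).val.map (Pi.evalRingHom (fun w' : PlacesOver L v => w'.1.adicCompletion L) w))).charpoly).IsRoot x) → ∀ ⦃n : ℕ⦄,
      Valued.v ((((γH.1.val : GL (Fin 2) (UnitaryGroup.LocalRing L v)).val.map (Pi.evalRingHom (fun w' : PlacesOver L v => w'.1.adicCompletion L) w))).trace ^ 2 - 4 * (((γH.1.val : GL (Fin 2) (UnitaryGroup.LocalRing L v)).val.map (Pi.evalRingHom (fun w' : PlacesOver L v => w'.1.adicCompletion L) w))).det) = WithZero.exp (-((2 * (2 * n + 1) : ℕ) : ℤ)) → 1 ≤ n →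
      ∀ (m : ℕ), Valued.v (((finCharpolyTwo L v γH).eval (finGammaTwo L v γH)) w) =
          Valued.v ((toPlace v w (HeckeCharacter.uniformizer ↥(maximalRealSubfield L) v : v.adicCompletion ↥(maximalRealSubfield L))) ^ m) →
        ∀ β : (v.adicCompletion ↥(maximalRealSubfield L))ˣ, toPlace v w (β : v.adicCompletion ↥(maximalRealSubfield L)) =
          -(((finCharpolyTwo L v γH).eval (finGammaTwo L v γH)) w *
              (finGammaTwo L v γH w ^ 2 +
                ((γH.1.val.val : Matrix (Fin 2) (Fin 2) (LocalRing L v)).map (Pi.evalRingHom (fun w' : PlacesOver L v => w'.1.adicCompletion L) w)).det)) /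
            (2 * finGammaTwo L v γH w ^ 2 *
              ((γH.1.val.val : Matrix (Fin 2) (Fin 2) (LocalRing L v)).map (Pi.evalRingHom (fun w' : PlacesOver L v => w'.1.adicCompletion L) w)).det) →
        ∀ yl : v.adicCompletion ↥(maximalRealSubfield L), toPlace v w yl = -(placeForm H' w.1).det →
        ∀ t₀ t₁ : ((cmDatum L 3 H').Local v), IsLocalNormPair L H' v γH t₀ → IsLocalNormPair L H' v γH t₁ →
        finKappaAt L v H' γH t₀ = hilbertSymbol (v.adicCompletion ↥(maximalRealSubfield L)) yl (algebraMap ↥(maximalRealSubfield L) _ ((cmQuadraticGenerator L : 𝓞 ↥(maximalRealSubfield L)) : ↥(maximalRealSubfield L))) → finKappaAt L v H' γH t₁ = -hilbertSymbol (v.adicCompletion ↥(maximalRealSubfield L)) yl (algebraMap ↥(maximalRealSubfield L) _ ((cmQuadraticGenerator L : 𝓞 ↥(maximalRealSubfield L)) : ↥(maximalRealSubfield L))) →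
        (∀ a b, Valued.v (((toPlace v w (HeckeCharacter.uniformizer ↥(maximalRealSubfield L) v : v.adicCompletion ↥(maximalRealSubfield L))) ^ 1)⁻¹ * ((((t₀).val : GL (Fin 3) (UnitaryGroup.LocalRing L v)).val.map (Pi.evalRingHom (fun w' : PlacesOver L v => w'.1.adicCompletion L) w)) a b - (1 : Matrix (Fin 3) (Fin 3) (w.1.adicCompletion L)) a b)) ≤ 1) → (∀ a b, Valued.v (((toPlace v w (HeckeCharacter.uniformizer ↥(maximalRealSubfield L) v : v.adicCompletion ↥(maximalRealSubfield L))) ^ 1)⁻¹ * ((((t₁).val : GL (Fin 3) (UnitaryGroup.LocalRing L v)).val.map (Pi.evalRingHom (fun w' : PlacesOver L v => w'.1.adicCompletion L) w)) a b - (1 : Matrix (Fin 3) (Fin 3) (w.1.adicCompletion L)) a b)) ≤ 1) →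
          ({M : Submodule (Valued.integer (w.1.adicCompletion L)) (Fin 3 → (w.1.adicCompletion L)) | IsSelfDualLattice (galAdicCompletionMap (L := L) (IsCMField.complexConj L) hw) ϖ (placeForm (Matrix.of fun i j : Fin 3 => if i.val + j.val + 1 = 3 then (1 : L) else 0) w.1) M ∧ mapGL ((e t₀ : ↥(unitaryGroupOfForm (galAdicCompletionMap (L := L) (IsCMField.complexConj L) hw) (placeForm (Matrix.of fun i j : Fin 3 => if i.val + j.val + 1 = 3 then (1 : L) else 0) w.1))) : GL (Fin 3) (w.1.adicCompletion L)) M = M ∧ M.map ((Matrix.toLin' ((((e t₀ : ↥(unitaryGroupOfForm (galAdicCompletionMap (L := L) (IsCMField.complexConj L) hw) (placeForm (Matrix.of fun i j : Fin 3 => if i.val + j.val + 1 = 3 then (1 : L) else 0) w.1))) : GL (Fin 3) (w.1.adicCompletion L)) : Matrix (Fin 3) (Fin 3) (w.1.adicCompletion L)) - 1)).restrictScalars (Valued.integer (w.1.adicCompletion L))) ≤ scaleLattice (ϖ ^ 2) M}.ncard : ℂ) - ({M : Submodule (Valued.integer (w.1.adicCompletion L)) (Fin 3 → (w.1.adicCompletion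 L)) | IsSelfDualLattice (galAdicCompletionMap (L := L) (IsCMField.complexConj L) hw) ϖ (placeForm (Matrix.of fun i j : Fin 3 => if i.val + j.val + 1 = 3 then (1 : L) else 0) w.1) M ∧ mapGL ((e t₁ : ↥(unitaryGroupOfForm (galAdicCompletionMap (L := L) (IsCMField.complexConj L) hw) (placeForm (Matrix.of fun i j : Fin 3 => if i.val + j.val + 1 = 3 then (1 : L) else 0) w.1))) : GL (Fin 3) (w.1.adicCompletion L)) M = M ∧ M.map ((Matrix.toLin' ((((e t₁ : ↥(unitaryGroupOfForm (galAdicCompletionMap (L := L) (IsCMField.complexConj L) hw) (placeForm (Matrix.of fun i j : Fin 3 => if i.val + j.val + 1 = 3 then (1 : L) else 0) w.1))) : GL (Fin 3) (w.1.adicCompletion L)) : Matrix (Fin 3) (Fin 3) (w.1.adicCompletion L)) - 1)).restrictScalars (Valued.integer (w.1.adicCompletion L))) ≤ scaleLattice (ϖ ^ 2) M}.ncard : ℂ) = ((hilbertSymbol (v.adicCompletion ↥(maximalRealSubfield L)) (β : v.adicCompletion ↥(maximalRealSubfield L)) (algebraMap ↥(maximalRealSubfield L) _ ((cmQuadraticGenerator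 L : 𝓞 ↥(maximalRealSubfield L)) : ↥(maximalRealSubfield L))) : ℤ) : ℂ) * ((Ideal.absNorm v.asIdeal : ℂ) ^ m * (2 * ((Ideal.absNorm v.asIdeal : ℂ) ^ n - 1) / (((Ideal.absNorm v.asIdeal : ℂ) - 1) * (Ideal.absNorm v.asIdeal : ℂ) ^ 2)))) :
        ∀ (e : ↥(UnitaryGroup.«local» L (IsCMField.complexConj L) 3 H' v) ≃ₜ* ↥(unitaryGroupOfForm (galAdicCompletionMap (L := L) (IsCMField.complexConj L) hw) (placeForm (Matrix.of fun i j : Fin 3 => if i.val + j.val + 1 = 3 then (1 : L) else 0) w.1)))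
      (heA : ∀ g : ((cmDatum L 3 H').Local v), (((e g) : ↥(unitaryGroupOfForm (galAdicCompletionMap (L := L) (IsCMField.complexConj L) hw) (placeForm (Matrix.of fun i j : Fin 3 => if i.val + j.val + 1 = 3 then (1 : L) else 0) w.1))) : GL (Fin 3) (w.1.adicCompletion L)) =
        A * ((localNonsplitEquiv (IsCMField.complexConj L) H' (IsCMField.complexConj_ne_one L) w hw g).val : GL (Fin 3) (w.1.adicCompletion L)) * A⁻¹)
      (hK : ∀ g : ((cmDatum L 3 H').Local v), g ∈ (cmLocalIntegralLevel L 3 H' v) ↔ (((e g) : ↥(unitaryGroupOfForm (galAdicCompletionMap (L := L) (IsCMField.complexConj L) hw) (placeForm (Matrix.of fun i j : Fin 3 => if i.val + j.val + 1 = 3 then (1 : L) else 0) w.1))) : GL (Fin 3) (w.1.adicCompletion L)) ∈ glInt 3 (w.1.adicCompletion L)),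
      ∀ ⦃γH : ((cmDatum L 2 (Matrix.of fun i j : Fin 2 => if i.val + j.val + 1 = 2 then (1 : L) else 0)).Local v × (cmDatum L 1 (Matrix.of fun i j : Fin 1 => if i.val + j.val + 1 = 1 then (1 : L) else 0)).Local v)⦄,
      (∀ i j : Fin 2, Valued.v (((((γH.1.val : GL (Fin 2) (UnitaryGroup.LocalRing L v)).val.map (Pi.evalRingHom (fun w' : PlacesOver L v => w'.1.adicCompletion L) w))) - 1) i j) ≤ Valued.v (ϖ ^ 2)) → Valued.v (finGammaTwo L v γH w - 1) ≤ Valued.v (ϖ ^ 2) → IsLocalGRegular L v γH →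
      (¬ ∃ x : (w.1.adicCompletion L), ((((γH.1.val : GL (Fin 2) (UnitaryGroup.LocalRing L v)).val.map (Pi.evalRingHom (fun w' : PlacesOver L v => w'.1.adicCompletion L) w))).charpoly).IsRoot x) → ∀ ⦃n : ℕ⦄,
      Valued.v ((((γH.1.val : GL (Fin 2) (UnitaryGroup.LocalRing L v)).val.map (Pi.evalRingHom (fun w' : PlacesOver L v => w'.1.adicCompletion L) w))).trace ^ 2 - 4 * (((γH.1.val : GL (Fin 2) (UnitaryGroup.LocalRing L v)).val.map (Pi.evalRingHom (fun w' : PlacesOver L v => w'.1.adicCompletion L) w))).det) = WithZero.exp (-((2 * (2 * n + 1) : ℕ) : ℤ)) → 1 ≤ n →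
      ∀ (m : ℕ), Valued.v (((finCharpolyTwo L v γH).eval (finGammaTwo L v γH)) w) =
          Valued.v ((toPlace v w (HeckeCharacter.uniformizer ↥(maximalRealSubfield L) v : v.adicCompletion ↥(maximalRealSubfield L))) ^ m) →
        ∀ tp tm : ((cmDatum L 3 H').Local v), IsLocalNormPair L H' v γH tp → IsLocalNormPair L H' v γH tm → finKappaAt L v H' γH tp = 1 → finKappaAt L v H' γH tm = -1 →
        (∀ a b, Valued.v (((toPlace v w (HeckeCharacter.uniformizer ↥(maximalRealSubfield L) v : v.adicCompletion ↥(maximalRealSubfield L))) ^ 1)⁻¹ * ((((tp).val : GL (Fin 3) (UnitaryGroup.LocalRing L v)).val.map (Pi.evalRingHom (fun w' : PlacesOver L v => w'.1.adicCompletion L) w)) a b - (1 : Matrix (Fin 3) (Fin 3) (w.1.adicCompletion L)) a b)) ≤ 1) → (∀ a b, Valued.v (((toPlace v w (HeckeCharacter.uniformizer ↥(maximalRealSubfield L) v : v.adicCompletion ↥(maximalRealSubfield L))) ^ 1)⁻¹ * ((((tm).val : GL (Fin 3) (UnitaryGroup.LocalRing L v)).val.map (Pi.evalRingHom (fun w'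 : PlacesOver L v => w'.1.adicCompletion L) w)) a b - (1 : Matrix (Fin 3) (Fin 3) (w.1.adicCompletion L)) a b)) ≤ 1) →
        (((∃ z : (w.1.adicCompletion L), z * galAdicCompletionMap (L := L) (IsCMField.complexConj L) hw z *
          ((placeForm H' w.1).det * ((finCharpolyTwo L v γH).eval (finGammaTwo L v γH)) w /
            ((1 + finGammaTwo L v γH w) ^ 2 * (1 + ((γH.1.val.val : Matrix (Fin 2) (Fin 2) (LocalRing L v)).map (Pi.evalRingHom (fun w' : PlacesOver L v => w'.1.adicCompletion L) w)).trace + ((γH.1.val.val : Matrix (Fin 2) (Fin 2) (LocalRing L v)).map (Pi.evalRingHom (fun w' : PlacesOver L v => w'.1.adicCompletion L) w)).det))) = 1) →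
          ({M : Submodule (Valued.integer (w.1.adicCompletion L)) (Fin 3 → (w.1.adicCompletion L)) | IsSelfDualLattice (galAdicCompletionMap (L := L) (IsCMField.complexConj L) hw) ϖ (placeForm (Matrix.of fun i j : Fin 3 => if i.val + j.val + 1 = 3 then (1 : L) else 0) w.1) M ∧ mapGL ((e tp : ↥(unitaryGroupOfForm (galAdicCompletionMap (L := L) (IsCMField.complexConj L) hw) (placeForm (Matrix.of fun i j : Fin 3 => if i.val + j.val + 1 = 3 then (1 : L) else 0) w.1))) : GL (Fin 3) (w.1.adicCompletion L)) M = M ∧ M.map ((Matrix.toLin' ((((e tp : ↥(unitaryGroupOfForm (galAdicCompletionMap (L := L) (IsCMField.complexConj L) hw) (placeForm (Matrix.of fun i j : Fin 3 => if i.val + j.val + 1 = 3 then (1 : L) else 0) w.1))) : GL (Fin 3) (w.1.adicCompletion L)) : Matrix (Fin 3) (Fin 3) (w.1.adicCompletion L)) - 1)).restrictScalars (Valued.integer (w.1.adicCompletion L))) ≤ scaleLattice (ϖ ^ 2) M}.ncard : ℂ) - ({M : Submodule (Valued.integer (w.1.adicCompletion L)) (Fin 3 → (w.1.adicCompletion L))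 | IsSelfDualLattice (galAdicCompletionMap (L := L) (IsCMField.complexConj L) hw) ϖ (placeForm (Matrix.of fun i j : Fin 3 => if i.val + j.val + 1 = 3 then (1 : L) else 0) w.1) M ∧ mapGL ((e tm : ↥(unitaryGroupOfForm (galAdicCompletionMap (L := L) (IsCMField.complexConj L) hw) (placeForm (Matrix.of fun i j : Fin 3 => if i.val + j.val + 1 = 3 then (1 : L) else 0) w.1))) : GL (Fin 3) (w.1.adicCompletion L)) M = M ∧ M.map ((Matrix.toLin' ((((e tm : ↥(unitaryGroupOfForm (galAdicCompletionMap (L := L) (IsCMField.complexConj L) hw) (placeForm (Matrix.of fun i j : Fin 3 => if i.val + j.val + 1 = 3 then (1 : L) else 0) w.1))) : GL (Fin 3) (w.1.adicCompletion L)) : Matrix (Fin 3) (Fin 3) (w.1.adicCompletion L)) - 1)).restrictScalars (Valued.integer (w.1.adicCompletion L))) ≤ scaleLattice (ϖ ^ 2) M}.ncard : ℂ) = (Ideal.absNorm v.asIdeal : ℂ) ^ m * (2 * ((Ideal.absNorm v.asIdeal : ℂ) ^ n - 1) / (((Ideal.absNorm v.asIdeal : ℂ) - 1) * (Ideal.absNorm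 v.asIdeal : ℂ) ^ 2))) ∧
        (¬ (∃ z : (w.1.adicCompletion L), z * galAdicCompletionMap (L := L) (IsCMField.complexConj L) hw z *
          ((placeForm H' w.1).det * ((finCharpolyTwo L v γH).eval (finGammaTwo L v γH)) w /
            ((1 + finGammaTwo L v γH w) ^ 2 * (1 + ((γH.1.val.val : Matrix (Fin 2) (Fin 2) (LocalRing L v)).map (Pi.evalRingHom (fun w' : PlacesOver L v => w'.1.adicCompletion L) w)).trace + ((γH.1.val.val : Matrix (Fin 2) (Fin 2) (LocalRing L v)).map (Pi.evalRingHom (fun w' : PlacesOver L v => w'.1.adicCompletion L) w)).det))) = 1) →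
          ({M : Submodule (Valued.integer (w.1.adicCompletion L)) (Fin 3 → (w.1.adicCompletion L)) | IsSelfDualLattice (galAdicCompletionMap (L := L) (IsCMField.complexConj L) hw) ϖ (placeForm (Matrix.of fun i j : Fin 3 => if i.val + j.val + 1 = 3 then (1 : L) else 0) w.1) M ∧ mapGL ((e tp : ↥(unitaryGroupOfForm (galAdicCompletionMap (L := L) (IsCMField.complexConj L) hw) (placeForm (Matrix.of fun i j : Fin 3 => if i.val + j.val + 1 = 3 then (1 : L) else 0) w.1))) : GL (Fin 3) (w.1.adicCompletion L)) M = M ∧ M.map ((Matrix.toLin' ((((e tp : ↥(unitaryGroupOfForm (galAdicCompletionMap (L := L) (IsCMField.complexConj L) hw) (placeForm (Matrix.of fun i j : Fin 3 => if i.val + j.val + 1 = 3 then (1 : L) else 0) w.1))) : GL (Fin 3) (w.1.adicCompletion L)) : Matrix (Fin 3) (Fin 3) (w.1.adicCompletion L)) - 1)).restrictScalars (Valued.integer (w.1.adicCompletion L))) ≤ scaleLattice (ϖ ^ 2) M}.ncard : ℂ) - ({M : Submodule (Valued.integer (w.1.adicCompletion L)) (Fin 3 → (w.1.adicCompletion L))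 | IsSelfDualLattice (galAdicCompletionMap (L := L) (IsCMField.complexConj L) hw) ϖ (placeForm (Matrix.of fun i j : Fin 3 => if i.val + j.val + 1 = 3 then (1 : L) else 0) w.1) M ∧ mapGL ((e tm : ↥(unitaryGroupOfForm (galAdicCompletionMap (L := L) (IsCMField.complexConj L) hw) (placeForm (Matrix.of fun i j : Fin 3 => if i.val + j.val + 1 = 3 then (1 : L) else 0) w.1))) : GL (Fin 3) (w.1.adicCompletion L)) M = M ∧ M.map ((Matrix.toLin' ((((e tm : ↥(unitaryGroupOfForm (galAdicCompletionMap (L := L) (IsCMField.complexConj L) hw) (placeForm (Matrix.of fun i j : Fin 3 => if i.val + j.val + 1 = 3 then (1 : L) else 0) w.1))) : GL (Fin 3) (w.1.adicCompletion L)) : Matrix (Fin 3) (Fin 3) (w.1.adicCompletion L)) - 1)).restrictScalars (Valued.integer (w.1.adicCompletion L))) ≤ scaleLattice (ϖ ^ 2) M}.ncard : ℂ) = -((Ideal.absNorm v.asIdeal : ℂ) ^ m * (2 * ((Ideal.absNorm v.asIdeal : ℂ) ^ n - 1) / (((Ideal.absNorm v.asIdeal : ℂ) - 1) * (Ideal.absNorm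 v.asIdeal : ℂ) ^ 2))))) := by
  intro e heA hK γH hblk hu2 hreg hirr n hdisc hn m hm tp tm htp htm hκp hκm hdp hdm
  obtain ⟨yl, hyl⟩ := exists_toPlace_eq_neg_det_placeForm L H' w hw hH'
  obtain ⟨β, hβ⟩ := exists_units_toPlace_eq_symmDisc_of_twoDeep L w hw he h2 ϖ hϖ hblk hu2 hreg
  have hF := exists_norm_mul_favourableClass_eq_one_iff_hilbertSymbol_mul_eq_one L H' w hw he hH'w h2 ϖ hϖ hblk hu2 hreg β hβ yl hyl
  have hb := hilbertSymbol_eq_one_or_eq_neg_one (F := v.adicCompletion ↥(maximalRealSubfield L)) (β : v.adicCompletion ↥(maximalRealSubfield L)) (algebraMap ↥(maximalRealSubfield L) _ ((cmQuadraticGenerator L : 𝓞 ↥(maximalRealSubfield L)) : ↥(maximalRealSubfield L)))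
  rcases hilbertSymbol_eq_one_or_eq_neg_one (F := v.adicCompletion ↥(maximalRealSubfield L)) yl (algebraMap ↥(maximalRealSubfield L) _ ((cmQuadraticGenerator L : 𝓞 ↥(maximalRealSubfield L)) : ↥(maximalRealSubfield L))) with hy | hy
  · have hI := hIntr e heA hK hblk hu2 hreg hirr hdisc hn m hm β hβ yl hyl tp tm htp htm (by rw [hκp, hy]) (by rw [hκm, hy]) hdp hdm
    rw [hy] at hF
    exact pairLaw_of_intrinsic_pos hb hF hI
  · have hI := hIntr e heA hK hblk hu2 hreg hirr hdisc hn m hm β hβ yl hyl tm tp htm htp (by rw [hκm, hy]) (by rw [hκp, hy]; norm_num) hdm hdp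
    rw [hy] at hF
    exact pairLaw_of_intrinsic_neg hb hF hI

end Wrappers

end Literature.NumberTheory.Rogawski1990

end
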